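import Mathlib

/-!
# The signed `π/6` intertwiner is Z-invariant: partition-level Yang–Baxter hexagons for BOTH row rapidities
# (crux `IKMixedBoxCrossing`, stmt-CriticalPhenomena-5911, line `defect-closure-exploration`, lead c6)

Helper file (`--supports stmt-CriticalPhenomena-5911`).  Context.  The landed column exchange of the crux's model
(`DiagramExchangeAt`, Theorems/…IKLinearTransportLine.lean + …StubDiagramExchange*.lean) rests on three kernel checks
(`…IKLinearTransport.PinnedDiagramExchange.DX.check_ybe/check_inv1/check_inv2`): the signed rhombus `R` (corner weight `-√3`,
horizontal diagonal `2`, vertical diagonal `-1`; the dilute `A₂⁽²⁾` face at spectral difference `π/6`) satisfies, at the level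
of boundary connectivity partitions of the 7-vertex hexagon, `[D(antiHon, iso) below R] ≡ [R below D(iso, antiHon)]`, where a
`D`-piece is a pair of faces of the two column types in ONE row: `iso` (rhombus angle `π/2`: corner fugacity `√3/2`, fair
diagonal) and `antiHon` (angle `π/3`: fugacity `1`, anti-diagonal forced).

This file adds the THIRD face type `mainHon` (angle `2π/3`: fugacity `1`, MAIN diagonal forced — the `y`-reflection of
`antiHon`) and certifies by the kernel that THE SAME `R` also satisfies

  `[D(iso, mainHon) below R] ≡ [R below D(mainHon, iso)]`            (`check_ybe_shifted`)

together with the two reverse hexagons driven by the partner `R'` (`check_ybe_plain_rev`, `check_ybe_shifted_rev`) and, for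
self-containedness in the three-type vocabulary, the original hexagon (`check_ybe_plain`).  Reading (isoradial / Baxter-lattice):
give the two column types rapidities `A, B` with `A - B = π/6` and allow two ROW rapidities, `plain = 0` and `shifted = -π/6`; the face
at (column, row) has rhombus angle (column rapidity − row rapidity): `(A, plain) = π/2 = iso`, `(B, plain) = π/3 = antiHon`,
`(A, shifted) = 2π/3 = mainHon`, `(B, shifted) = π/2 = iso` — all four probabilistic (`q = 1/2 + (√3/2) cot θ ∈ [0,1]`,
`t = √3 / (2 sin θ)`), and the column intertwiner depends only on `A - B`.  The two hexagon identities are exactly the local moves a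
"train" of `R`'s needs in a plain row and in a shifted row, so the train argument of …StubDiagramExchange*.lean (which is row-local)
extends verbatim to cylinders `Fin 3 × ℤ/L` with an ARBITRARY sequence of row rapidities: the crux's weights are Z-invariant on the
doubly-typed lattice, which is closed under transposition (`(κ, σ) ↦ (ι σ, ι' κ)`), so ROW exchange is exact as well as column
exchange.  (The other assignments are certified FALSE in the lead's scratch file `work/scratch_ybe2.lean` by `native_decide`:
`D(mainHon, iso)·R ≢ R·D(iso, mainHon)`, and no hexagon with `R` or `R'` exchanges `antiHon` against `mainHon` — their rapidity
difference is `π/3`, a different intertwiner.)  What is deliberately NOT here: the lift to the cylinder block (bookkeeping identical to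
the landed train), any probabilistic statement.  References: A. Morin-Duchesne, A. Klümper, P. A. Pearce, arXiv:2211.12379 §2.2, §3.6
(local weights, spectral parameter); G. Grimmett, I. Manolescu, arXiv:1204.0505 §4.6–§5.3 (isoradial square lattices with two
arbitrary angle sequences, track exchange); lead memo `Cruxes/IKMixedBoxCrossing/Lines/defect-closure-exploration-c6.md`.
-/

namespace Summit.CriticalPhenomena.CardyFormulaZ2.Theorems.IKMixedBoxCrossing.RowTypedYBE

namespace RY

/-! ## §1 Three face types, local pieces, the hexagon template -/

/-- Face types of the dilute `A₂⁽²⁾` family at the three probabilistic rhombus angles used by the doubly-typed lattice: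
isotropic (`π/2`), anti-diagonal honeycomb (`π/3`), main-diagonal honeycomb (`2π/3`). -/
inductive Face
  | iso
  | antiHon
  | mainHon
  deriving DecidableEq

/-- Piece kinds: a double face `D f₀ f₁` (face types of the two columns in one row), the intertwiners `R`, `R'`,
the identity. -/
inductive Kind
  | D (f₀ f₁ : Face)
  | R
  | R'
  | I
  deriving DecidableEq

/-- `√3 ∈ ℤ√3`. -/
def sq3 : ℤ√3 := ⟨0, 1⟩

/-- Four times the face weight, from the corner parity `odd` and the anti-diagonal flag `anti` of the face:
`iso ↦ √3·[odd] + 2·[even]` (fair diagonal), `antiHon ↦ 4·[anti]`, `mainHon ↦ 4·[¬anti]`. -/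
def fwZ : Face → (odd anti : Bool) → ℤ√3
  | .iso, odd, _ => if odd then sq3 else 2
  | .antiHon, _, anti => if anti then 4 else 0
  | .mainHon, _, anti => if anti then 0 else 4

/-- Rhombus weight (corners `a`, `lo`, `b`, `hi` in cyclic order; `bits.1`: vertical diagonal); verbatim the landed `DX.rhW`. -/
def rhW (rc x y : ℤ√3) (ca cb clo chi : Bool) (bits : Bool × Bool) : ℤ√3 :=
  if bits.2 then 0 else
  if (ca == cb) && (cb == clo) && (clo == chi) then (if bits.1 then 0 else 1)
  else if (ca == cb) && (clo == chi) then (if bits.1 then y else x)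
  else if ((ca == clo) && (cb == chi)) || ((ca == chi) && (cb == clo)) then (if bits.1 then 0 else 1)
  else (if bits.1 then 0 else rc)

/-- Piece weight from the six local colours `a b c d lo hi` and the two bits (`R`: corner `-√3`, horizontal `2`, vertical `-1`;
`R'`: corner `√3`, horizontal `-1`, vertical `2`); verbatim the landed `DX.pieceW` with three face types. -/
def pieceW : Kind → (ca cb cc cd clo chi : Bool) → Bool × Bool → ℤ√3
  | .D f₀ f₁, ca, cb, cc, cd, clo, chi, bits =>
      fwZ f₀ ((ca ^^ clo) ^^ (cc ^^ chi)) bits.1 * fwZ f₁ ((clo ^^ cb) ^^ (chi ^^ cd)) bits.2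
  | .R, ca, cb, _, _, clo, chi, bits => rhW (-sq3) 2 (-1) ca cb clo chi bits
  | .R', ca, cb, _, _, clo, chi, bits => rhW sq3 (-1) 2 ca cb clo chi bits
  | .I, _, _, _, _, clo, chi, bits => if (clo == chi) && (bits == (false, false)) then 1 else 0

/-- Conditional edge. -/
def ce {W : Type*} (p : Bool) (u v : W) : List (W × W) := if p then [(u, v)] else []

/-- Rhombus edges (monochromatic ones only). -/
def rhE {W : Type*} (ca cb clo chi d : Bool) (a b vl vh : W) : List (W × W) :=
  ce (ca == clo) a vl ++ ce (clo == cb) vl b ++ ce (cb == chi) b vh ++ ce (chi == ca) vh a ++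
  ce (d && (clo == chi)) vl vh ++ ce (!d && (ca == cb)) a b

/-- Piece edges (monochromatic ones only); the `D`-piece reads its two diagonals from the bits exactly as the landed `DX.pieceE`
(`bits.i = true`: anti-diagonal of face `i`), so the face TYPE enters only through the weight. -/
def pieceE {W : Type*} : Kind → (ca cb cc cd clo chi : Bool) → Bool × Bool →
    (a b c d vl vh : W) → List (W × W)
  | .D _ _, ca, cb, cc, cd, clo, chi, bits, a, b, c, d, vl, vh =>
      ce (ca == cc) a c ++ ce (cb == cd) b d ++ ce (ca == clo) a vl ++ ce (clo == cb) vl b ++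
      ce (cc == chi) c vh ++ ce (chi == cd) vh d ++ ce (clo == chi) vl vh ++
      ce (bits.1 && (cc == clo)) c vl ++ ce (!bits.1 && (ca == chi)) a vh ++
      ce (bits.2 && (chi == cb)) vh b ++ ce (!bits.2 && (clo == cd)) vl d
  | .R, ca, cb, _, _, clo, chi, bits, a, b, _, _, vl, vh => rhE ca cb clo chi bits.1 a b vl vh
  | .R', ca, cb, _, _, clo, chi, bits, a, b, _, _, vl, vh => rhE ca cb clo chi bits.1 a b vl vh
  | .I, ca, cb, _, _, clo, chi, _, a, b, _, _, vl, vh =>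
      ce (ca == clo) a vl ++ ce (clo == cb) vl b ++ ce (ca == chi) a vh ++ ce (chi == cb) vh b ++
      ce (clo == chi) vl vh

/-- A two-piece window: lower kind, upper kind, whether the upper piece sits one row higher. -/
structure WinDesc where
  /-- lower piece -/
  lo : Kind
  /-- upper piece -/
  hi : Kind
  /-- upper piece shifted one row up -/
  shift : Bool

/-- In-window configuration: middle colour, lower bits, upper bits. -/
abbrev WinIn : Type := Bool × (Bool × Bool) × (Bool × Bool)

/-- Window edges on the template `Fin 7` (`0:a 1:b 2:c 3:d 4:lo 5:hi 6:m`). -/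
def winE (d : WinDesc) (c0 c1 c2 c3 c4 c5 : Bool) (x : WinIn) : List (Fin 7 × Fin 7) :=
  pieceE d.lo c0 c1 c2 c3 c4 x.1 x.2.1 0 1 2 3 4 6 ++
  (if d.shift then pieceE d.hi c2 c3 c2 c3 x.1 c5 x.2.2 2 3 2 3 6 5
   else pieceE d.hi c0 c1 c2 c3 x.1 c5 x.2.2 0 1 2 3 6 5)

/-- Window weight. -/
def winW (d : WinDesc) (c0 c1 c2 c3 c4 c5 : Bool) (x : WinIn) : ℤ√3 :=
  pieceW d.lo c0 c1 c2 c3 c4 x.1 x.2.1 *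
  (if d.shift then pieceW d.hi c2 c3 c2 c3 x.1 c5 x.2.2 else pieceW d.hi c0 c1 c2 c3 x.1 c5 x.2.2)

/-! ## §2 Certified closure and the boundary-partition check (verbatim the landed `DX` versions) -/

/-- One relaxation step along an edge. -/
def rstep (S : ℕ) (e : Fin 7 × Fin 7) : ℕ :=
  if S.testBit e.1.val || S.testBit e.2.val then S ||| 2 ^ e.1.val ||| 2 ^ e.2.val else S

/-- One relaxation pass. -/
def relax (es : List (Fin 7 × Fin 7)) (S : ℕ) : ℕ := es.foldl rstep S

/-- Reach-set bitmask after four passes. -/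
def reach (es : List (Fin 7 × Fin 7)) (src : Fin 7) : ℕ := (relax es)^[4] (2 ^ src.val)

/-- Closedness of a bitmask under the edges. -/
def closedB (es : List (Fin 7 × Fin 7)) (S : ℕ) : Bool :=
  es.all fun e => S.testBit e.1.val == S.testBit e.2.val

/-- The six boundary reach sets. -/
def reaches (es : List (Fin 7 × Fin 7)) : List ℕ :=
  [reach es 0, reach es 1, reach es 2, reach es 3, reach es 4, reach es 5]

/-- Table entry: boundary signature, weight, closure certificate. -/
structure Entry where
  /-- boundary signature -/
  sg : List ℕ
  /-- weight -/
  w : ℤ√3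
  /-- the reach sets are certified closed -/
  ok : Bool

/-- The four bit pairs. -/
def allBits : List (Bool × Bool) := [(false, false), (false, true), (true, false), (true, true)]

/-- All in-window configurations. -/
def allCin : List WinIn :=
  [false, true].flatMap fun cm => allBits.flatMap fun bl => allBits.map fun bh => (cm, bl, bh)

/-- Entry of one in-configuration. -/
def mkEntry (es : List (Fin 7 × Fin 7)) (w : ℤ√3) : Entry :=
  let rs := reaches es
  ⟨rs.map (· % 64), w, rs.all (closedB es)⟩

/-- Table of a window (nonzero weights only). -/
def table (d : WinDesc) (c0 c1 c2 c3 c4 c5 : Bool) : List Entry :=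
  allCin.filterMap fun x =>
    let w := winW d c0 c1 c2 c3 c4 c5 x
    if w = 0 then none else some (mkEntry (winE d c0 c1 c2 c3 c4 c5 x) w)

/-- Fibre sum over a boundary signature. -/
def sumAt (t : List Entry) (σ : List ℕ) : ℤ√3 :=
  t.foldr (fun e acc => (if e.sg = σ then e.w else 0) + acc) 0

/-- Per-boundary-colouring check of a windowed identity `κ·[dL] ≡ κ'·[dR]` in the coloured partition category. -/
def checkCb (dL dR : WinDesc) (κ κ' : ℤ√3) (c0 c1 c2 c3 c4 c5 : Bool) : Bool :=
  let tL := table dL c0 c1 c2 c3 c4 c5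
  let tR := table dR c0 c1 c2 c3 c4 c5
  (tL.all (·.ok) && tR.all (·.ok)) &&
  (tL ++ tR).all fun e => decide (κ * sumAt tL e.sg = κ' * sumAt tR e.sg)

/-! ## §3 The four hexagons -/

/-- Plain row, left: `D(antiHon, iso)` below `R` (the landed `DX.ybeL` in the three-type vocabulary). -/
def ybePlainL : WinDesc := ⟨.D .antiHon .iso, .R, true⟩
/-- Plain row, right: `R` below `D(iso, antiHon)`. -/
def ybePlainR : WinDesc := ⟨.R, .D .iso .antiHon, false⟩
/-- Shifted row, left: `D(iso, mainHon)` below `R` (NEW). -/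
def ybeShiftL : WinDesc := ⟨.D .iso .mainHon, .R, true⟩
/-- Shifted row, right: `R` below `D(mainHon, iso)`. -/
def ybeShiftR : WinDesc := ⟨.R, .D .mainHon .iso, false⟩
/-- Plain row, reverse direction, left: `D(iso, antiHon)` below `R'`. -/
def ybePlainRevL : WinDesc := ⟨.D .iso .antiHon, .R', true⟩
/-- Plain row, reverse direction, right: `R'` below `D(antiHon, iso)`. -/
def ybePlainRevR : WinDesc := ⟨.R', .D .antiHon .iso, false⟩
/-- Shifted row, reverse direction, left: `D(mainHon, iso)` below `R'` (NEW). -/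
def ybeShiftRevL : WinDesc := ⟨.D .mainHon .iso, .R', true⟩
/-- Shifted row, reverse direction, right: `R'` below `D(iso, mainHon)`. -/
def ybeShiftRevR : WinDesc := ⟨.R', .D .iso .mainHon, false⟩

set_option maxHeartbeats 1000000 in
/-- KERNEL CHECK (plain row): `[D(antiHon, iso) below R] ≡ [R below D(iso, antiHon)]`. -/
theorem check_ybe_plain (c0 c1 c2 c3 c4 c5 : Bool) : checkCb ybePlainL ybePlainR 1 1 c0 c1 c2 c3 c4 c5 = true := by
  revert c0 c1 c2 c3 c4 c5; decide +kernel

set_option maxHeartbeats 1000000 in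
/-- KERNEL CHECK (shifted row, NEW): `[D(iso, mainHon) below R] ≡ [R below D(mainHon, iso)]` — the same signed `π/6`
rhombus intertwines the isotropic face against the MAIN-diagonal honeycomb face. -/
theorem check_ybe_shifted (c0 c1 c2 c3 c4 c5 : Bool) : checkCb ybeShiftL ybeShiftR 1 1 c0 c1 c2 c3 c4 c5 = true := by
  revert c0 c1 c2 c3 c4 c5; decide +kernel

set_option maxHeartbeats 1000000 in
/-- KERNEL CHECK (plain row, reverse): `[D(iso, antiHon) below R'] ≡ [R' below D(antiHon, iso)]`. -/
theorem check_ybe_plain_rev (c0 c1 c2 c3 c4 c5 : Bool) :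
    checkCb ybePlainRevL ybePlainRevR 1 1 c0 c1 c2 c3 c4 c5 = true := by
  revert c0 c1 c2 c3 c4 c5; decide +kernel

set_option maxHeartbeats 1000000 in
/-- KERNEL CHECK (shifted row, reverse, NEW): `[D(mainHon, iso) below R'] ≡ [R' below D(iso, mainHon)]`. -/
theorem check_ybe_shifted_rev (c0 c1 c2 c3 c4 c5 : Bool) :
    checkCb ybeShiftRevL ybeShiftRevR 1 1 c0 c1 c2 c3 c4 c5 = true := by
  revert c0 c1 c2 c3 c4 c5; decide +kernel

end RY

/-- REGISTERED SUB-GOAL (lead c6, helper toward the crux's transport programme): the four kernel-checked partition-level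
Yang–Baxter hexagons of the signed `π/6` intertwiner — plain row and shifted row, both directions.  With the landed inversion
relations (`DX.check_inv1/2`, which involve `R, R'` only) these are all the local moves of a train through a cylinder block whose
rows carry arbitrary rapidities in `{plain, shifted}`: the crux's dilute `A₂⁽²⁾` weights are Z-invariant on the doubly-typed
Baxter lattice. -/
theorem rowTypedYBE_kernelChecks : (∀ c0 c1 c2 c3 c4 c5 : Bool, RY.checkCb RY.ybePlainL RY.ybePlainR 1 1 c0 c1 c2 c3 c4 c5 = true) ∧ (∀ c0 c1 c2 c3 c4 c5 : Bool, RY.checkCb RY.ybeShiftL RY.ybeShiftR 1 1 c0 c1 c2 c3 c4 c5 = true) ∧ (∀ c0 c1 c2 c3 c4 c5 : Bool, RY.checkCb RY.ybePlainRevL RY.ybePlainRevR 1 1 c0 c1 c2 c3 c4 c5 = true) ∧ (∀ c0 c1 c2 c3 c4 c5 : Bool, RY.checkCb RY.ybeShiftRevL RY.ybeShiftRevR 1 1 c0 c1 c2 c3 c4 c5 = true) :=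
  ⟨RY.check_ybe_plain, RY.check_ybe_shifted, RY.check_ybe_plain_rev, RY.check_ybe_shifted_rev⟩

end Summit.CriticalPhenomena.CardyFormulaZ2.Theorems.IKMixedBoxCrossing.RowTypedYBE
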